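-- line stmt-HodgeConjecture-18881 Cruxes/BlochSeedDiscOne/Lines/birth.lean 814a6a70c14e831a stub_rung_pad4_seedAt
import Mathlib

/-!
# U-MIX closing arithmetic (hsemireg-alphabet-unipotent-1, g19) — kernel-checked shadow of memo §4

Design bd78f9c7be1aac4e, cell X0 = N[[8,-4,0],[11,0,1],[12,0,0],[12,0,0]] (M = 176 695), profit arrow a₁ (N = 1 780 509).
Only the integer bookkeeping of THEOREM U-MIX is checked here; the geometry (LEMMA GERM, LEMMA M3, the dictionary) is a
pen proof in `g19/memo/U-MIX-unipotent1-g19.md`. Nothing here is proved toward HC / HC_CM / HC_AV / №4 / 26512 / 18881 / H2.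
-/

namespace HsemiregUnipotent1.G19

/-- profit per unit (m, s, β_y) of the a₁-cell: 64 · N_{a₁}. -/
def uprime : ℕ := 113952576
theorem uprime_eq : uprime = 64 * 1780509 := by norm_num [uprime]

/-- LP constant of the y-sources (terms with y ∈ A, bounded by binom · β_y), with the K-ROW cap on S1-A. -/
def c_y : ℕ := 33027644
/-- LP constant of the non-y sources (terms with y ∉ A, bounded by binom · ℓ(W)). -/
def c_nz : ℕ := 7132126
/-- u* = u′ − c_y. -/
def ustar : ℕ := 80924932
theorem ustar_eq : ustar = uprime - c_y := by norm_num [ustar, uprime, c_y]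

/-- rank of the cell, three times the TRIPLE-LAW reach constant ℛ = 395 221 / 3, the door. -/
def M : ℕ := 176695
def R3 : ℕ := 395221
def DOOR : ℕ := 5572

/-- W₀′ = S2(0100) + S3 residual (after LEMMA M3) + S5 coarse, at s = 1 (scales s²). -/
def W0' : ℕ := 6342458738052
theorem W0'_eq : W0' = 6341371828950 + 963271260 + 123637842 := by norm_num [W0']

/-- 3B := u*·R3 − 3·(c_nz·M + W₀′ + ½κ₁·M + κ_ψ·M) with κ₁ = 18, κ_ψ = 21. -/
def threeB : ℤ := (ustar : ℤ) * R3 - 3 * ((c_nz : ℤ) * M + W0' + 9 * M + 21 * M)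
theorem threeB_eq : threeB = 9175207422556 := by norm_num [threeB, ustar, R3, c_nz, M, W0']

/-- THEOREM U-MIX, s = 1: 3·U ≥ 3B − 3·2786 > 3·5572. -/
theorem closing : threeB - 3 * 2786 > 3 * (DOOR : ℤ) := by
  rw [threeB_eq]; norm_num [DOOR]

/-- THEOREM U-MIX at every scale: 3·U_{X*}(s) ≥ 3B·s² − 3·2786 > 3·5572 for all s ≥ 1. -/
theorem closing_all_scales (s : ℤ) (hs : 1 ≤ s) : threeB * s ^ 2 - 3 * 2786 > 3 * (DOOR : ℤ) := by
  rw [threeB_eq]; simp only [DOOR]; push_cast; nlinarith [hs, sq_nonneg s]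

/-- the quoted margin (u*ℛ − W₀′)/(c_nz·M) exceeds 3 (it is 3.427…). -/
theorem margin_gt_three : (ustar : ℤ) * R3 - 3 * (W0' : ℤ) > 3 * (3 * ((c_nz : ℤ) * M)) := by
  norm_num [ustar, R3, W0', c_nz, M]

/-- Table 3 row "GERM (K-ROW) only": without LEMMA M3 the bracket is negative (no kill by this bookkeeping). -/
theorem open_without_M3 :
    (ustar : ℤ) * R3 - 3 * ((c_nz : ℤ) * M + 31099606665858 + 9 * M + 21 * M) = -65096236360862 := by
  norm_num [ustar, R3, c_nz, M]

/-- Table 3 row "coarse, no lemma": even the reference arc's pattern value is negative, u′·ℛ < W₀^coarse. -/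
theorem coarse_reference_arc_negative : (uprime : ℤ) * R3 < 3 * 37440059752164 := by
  norm_num [uprime, R3]

/-- the M3 block is 99.996 % of the S3 coarse weight at X0 (strictly more than 99.99 %). -/
theorem M3_block_share : (10000 : ℤ) * 24757147927806 > 9999 * 24758111199066 := by norm_num

end HsemiregUnipotent1.G19
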